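import Literature.Probability.Percolation.CoveringTameFibres
import Literature.Probability.Percolation.EnhancedClusterModification
import Literature.Probability.Percolation.CoveringQuotientTwoLifts
import HarnessLib

/-!
# Lifted structures around a vertex of the cover (Martineau–Severo 2019, Lemma 5.1, group case)

Eighth file of the inline proof of `Literature.Probability.Percolation.MartineauSevero2019_cor22`.
Martineau–Severo (Ann. Probab. 47 (2019), Lemma 5.1) attach to every vertex `x` of `𝒢` (with `u = π x`) a
finite connected set `Z(x, r) ∋ x` of `π⁻¹(B_r(u))` such that every `b ∈ S_{r+1}(u)` has TWO lifts adjacent to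
`Z` — more precisely two distinct lifts of one `ℋ`-edge `{a, b}`, `a ∈ S_r(u)`, hanging off `Z` — built from
two vertex-disjoint lifts of a spanning tree of `B_{r+1}(u)` (disjoint tree lifting, Lemma 7.1, from freeness)
joined by a geodesic from `x` to a nearby point `y` of its fibre (tame fibres, Lemma 7.2). This is what the
`s`-exploration of §5 reads. In the group case the second lift is the translate by the tame element
`g_x ≠ 1` (`d(x, g_x x) ≤ r`), and trees are not needed: for each `b` separately we lift a geodesic.

* `TameLift r x` — a choice of `g ≠ 1` and a walk `x → g • x` of length `≤ r` (`nonempty_tameLift` from the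
  tameness radius of `CoveringTameFibres.lean`).
* `BLift r x b` — for `b` with `dist(π x, b) = r + 1`: a walk of length `≤ r` from `x` to a vertex `near` and a
  neighbour `far` of `near` with `π far = b` (`nonempty_bLift`: lift a geodesic to the predecessor of `b`, then
  lift the last edge).
* Projections: all vertices met project into `B_r(u)` (`BLift.proj_mem_of_mem_edges`,
  `TameLift.proj_mem_of_mem_edges`, and the translates), the boundary edge `s(near, far)` and its translate
  `s(g near, g far)` are two DISTINCT lifts (`BLift.edge₁_ne_edge₂`, by freeness) of the `ℋ`-edge
  `s(π near, b)` (`BLift.map_edge₁`, `BLift.map_edge₂`), which lies in `E(B_{r+1}(u))`.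

## References

* S. Martineau, F. Severo, Ann. Probab. 47 (2019), §5 Lemma 5.1 (the set Z(x,r)), §7 Lemmas 7.1, 7.2
  [MartineauSevero2019].
-/

noncomputable section

namespace Literature.Probability.Percolation

open Literature.Barriers.CriticalPhenomena
open scoped Classical

variable {V : Type*} {Γ : Type*} [Group Γ] [MulAction Γ V]

/-! ### Walks: supports, projections, translates -/

section Walks

variable {G : SimpleGraph V}

/-- Endpoints of the edges of a walk of length `≤ n` from `x` project into `B_n(π x)`.
[cite: MartineauSevero2019, §2 (π is 1-Lipschitz)] -/
theorem qmk_mem_graphBall_of_mem_edges {x y : V} (w : G.Walk x y) {n : ℕ} (hn : w.length ≤ n) {f : Sym2 V}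
    (hf : f ∈ w.edges) {z : V} (hz : z ∈ f) :
    qmk Γ z ∈ graphBall (orbitQuotientGraph G Γ) (qmk Γ x) n :=
  graphBall_mono _ _ hn (qmk_mem_graphBall (support_subset_graphBall_start w (w.mem_support_of_mem_edges hf hz)))

/-- The translate `g • w` of a walk by an element acting by automorphisms. [folklore] -/
def smulWalk (hact : IsActionByAut G Γ) (g : Γ) {x y : V} (w : G.Walk x y) : G.Walk (g • x) (g • y) :=
  w.map (smulIso hact g).toHom

/-- The translate has the same length. [folklore] -/
@[simp] theorem length_smulWalk (hact : IsActionByAut G Γ) (g : Γ) {x y : V} (w : G.Walk x y) :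
    (smulWalk hact g w).length = w.length :=
  SimpleGraph.Walk.length_map _ _

/-- The edges of the translate are the translated edges. [folklore] -/
theorem edges_smulWalk (hact : IsActionByAut G Γ) (g : Γ) {x y : V} (w : G.Walk x y) :
    (smulWalk hact g w).edges = w.edges.map (Sym2.map (smulIso hact g)) :=
  SimpleGraph.Walk.edges_map _ _

/-- Endpoints of the edges of the translate of a walk of length `≤ n` from `x` project into `B_n(π x)`
(`π (g • z) = π z`). [cite: MartineauSevero2019, §2 (π is 1-Lipschitz)] -/
theorem qmk_mem_graphBall_of_mem_edges_smulWalk (hact : IsActionByAut G Γ) (g : Γ) {x y : V} (w : G.Walk x y)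
    {n : ℕ} (hn : w.length ≤ n) {f : Sym2 V} (hf : f ∈ (smulWalk hact g w).edges) {z : V} (hz : z ∈ f) :
    qmk Γ z ∈ graphBall (orbitQuotientGraph G Γ) (qmk Γ x) n := by
  rw [edges_smulWalk, List.mem_map] at hf
  obtain ⟨f', hf', rfl⟩ := hf
  obtain ⟨z', hz', rfl⟩ := Sym2.mem_map.1 hz
  rw [show (smulIso hact g) z' = g • z' from rfl, qmk_smul]
  exact qmk_mem_graphBall_of_mem_edges w hn hf' hz'

end Walks

/-! ### The tame translate -/

/-- A **tame lift at `x`**: an element `g ≠ 1` and a walk from `x` to `g • x` of length `≤ r` (tame fibres,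
Lemma 7.2; the geodesic `γ` from `x` to `y` of Lemma 5.1). [cite: MartineauSevero2019, Lemma 5.1 (the geodesic γ from x to y)] -/
structure TameLift (G : SimpleGraph V) (Γ : Type*) [Group Γ] [MulAction Γ V] (r : ℕ) (x : V) where
  /-- the deck transformation -/
  g : Γ
  /-- it is not the identity -/
  g_ne_one : g ≠ 1
  /-- a short walk to the translate -/
  walk : G.Walk x (g • x)
  /-- of length at most `r` -/
  length_le : walk.length ≤ r

/-- Tame fibres give tame lifts. [cite: MartineauSevero2019, Lemma 7.2] -/
theorem nonempty_tameLift {G : SimpleGraph V} {r : ℕ} (htame : ∀ x : V, ∃ g : Γ, g ≠ 1 ∧ g • x ∈ graphBall G x r)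
    (x : V) : Nonempty (TameLift G Γ r x) := by
  obtain ⟨g, hg, ⟨w, hw⟩⟩ := htame x
  exact ⟨⟨g, hg, w, hw⟩⟩

/-- A chosen tame lift at every vertex. [cite: MartineauSevero2019, Lemma 7.2] -/
def tameLift {G : SimpleGraph V} {r : ℕ} (htame : ∀ x : V, ∃ g : Γ, g ≠ 1 ∧ g • x ∈ graphBall G x r) (x : V) :
    TameLift G Γ r x :=
  Classical.choice (nonempty_tameLift htame x)

namespace TameLift

variable {G : SimpleGraph V} {r : ℕ} {x : V}

/-- Endpoints of the edges of the tame walk project into `B_r(π x)`. [cite: MartineauSevero2019, Lemma 5.1 (γ stays inside π⁻¹(B_r(π(x))))] -/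
theorem proj_mem_of_mem_edges (τ : TameLift G Γ r x) {f : Sym2 V} (hf : f ∈ τ.walk.edges) {z : V} (hz : z ∈ f) :
    qmk Γ z ∈ graphBall (orbitQuotientGraph G Γ) (qmk Γ x) r :=
  qmk_mem_graphBall_of_mem_edges τ.walk τ.length_le hf hz

/-- The translate `g • x` is a different vertex of the fibre of `x` (freeness). [cite: MartineauSevero2019, Lemma 7.1 ("g has no fixed point")] -/
theorem smul_ne (hfree : ∀ (g : Γ) (x : V), g • x = x → g = 1) (τ : TameLift G Γ r x) (z : V) : τ.g • z ≠ z :=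
  fun h => τ.g_ne_one (hfree τ.g z h)

end TameLift

/-! ### Lifted geodesics to the sphere `S_{r+1}(π x)` -/

/-- A **boundary lift** at `x` towards `b ∈ S_{r+1}(π x)`: a walk of length `≤ r` from `x` to `near`, and a
neighbour `far` of `near` projecting to `b` (a lift of a geodesic from `π x` to `b`; Lemma 5.1's lift of the
tree edge to `b`). [cite: MartineauSevero2019, Lemma 5.1 (lifts of the spanning tree of B_{r+1}(π(x)))] -/
structure BLift (G : SimpleGraph V) (Γ : Type*) [Group Γ] [MulAction Γ V] (r : ℕ) (x : V)
    (b : MulAction.orbitRel.Quotient Γ V) where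
  /-- the last vertex of the lifted geodesic inside `π⁻¹(B_r(π x))` -/
  near : V
  /-- its neighbour above `b` -/
  far : V
  /-- the lifted geodesic -/
  walk : G.Walk x near
  /-- the last edge -/
  adj : G.Adj near far
  /-- `far` lies above `b` -/
  far_proj : qmk Γ far = b
  /-- the lifted geodesic is short -/
  length_le : walk.length ≤ r

/-- **Existence of boundary lifts**: lift a geodesic from `π x` to the predecessor of `b`, then lift the last
edge (weak lifting). [cite: MartineauSevero2019, Lemma 5.1 (proof)] -/
theorem nonempty_bLift {G : SimpleGraph V} (hact : IsActionByAut G Γ) (hG : G.Connected) {r : ℕ} {x : V}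
    {b : MulAction.orbitRel.Quotient Γ V} (hb : (orbitQuotientGraph G Γ).dist (qmk Γ x) b = r + 1) :
    Nonempty (BLift G Γ r x b) := by
  have hH : (orbitQuotientGraph G Γ).Connected := quot_connected hG
  obtain ⟨a, hab, ha⟩ := exists_adj_mem_graphBall_of_dist_eq hH hb
  obtain ⟨w, hw⟩ := ha
  obtain ⟨near, hnear, w', hw'⟩ := exists_lift_walk hact w (x := x) rfl
  obtain ⟨far, hadj, hfar⟩ := exists_adj_of_quot_adj hact (x := near) (u := b) (by rw [hnear]; exact hab)
  exact ⟨⟨near, far, w', hadj, hfar, by rw [hw']; exact hw⟩⟩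

/-- A chosen boundary lift. [cite: MartineauSevero2019, Lemma 5.1] -/
def bLift {G : SimpleGraph V} (hact : IsActionByAut G Γ) (hG : G.Connected) {r : ℕ} (x : V)
    (b : MulAction.orbitRel.Quotient Γ V) (hb : (orbitQuotientGraph G Γ).dist (qmk Γ x) b = r + 1) :
    BLift G Γ r x b :=
  Classical.choice (nonempty_bLift hact hG hb)

namespace BLift

variable {G : SimpleGraph V} {r : ℕ} {x : V} {b : MulAction.orbitRel.Quotient Γ V}

/-- `π near ∈ B_r(π x)`. [cite: MartineauSevero2019, Lemma 5.1] -/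
theorem near_proj_mem (β : BLift G Γ r x b) : qmk Γ β.near ∈ graphBall (orbitQuotientGraph G Γ) (qmk Γ x) r :=
  graphBall_mono _ _ β.length_le (qmk_mem_graphBall ⟨β.walk, le_rfl⟩)

/-- Endpoints of the edges of the lifted geodesic project into `B_r(π x)`. [cite: MartineauSevero2019, Lemma 5.1] -/
theorem proj_mem_of_mem_edges (β : BLift G Γ r x b) {f : Sym2 V} (hf : f ∈ β.walk.edges) {z : V} (hz : z ∈ f) :
    qmk Γ z ∈ graphBall (orbitQuotientGraph G Γ) (qmk Γ x) r :=
  qmk_mem_graphBall_of_mem_edges β.walk β.length_le hf hz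

/-- `π near ≠ b` (distances `≤ r` and `r + 1` from `π x`). [cite: MartineauSevero2019, Lemma 5.1] -/
theorem near_proj_ne (β : BLift G Γ r x b)
    (hb : (orbitQuotientGraph G Γ).dist (qmk Γ x) b = r + 1) : qmk Γ β.near ≠ b := by
  intro h
  have := dist_le_of_mem_graphBall β.near_proj_mem
  rw [h, hb] at this
  omega

/-- **The `ℋ`-edge `s(π near, b)`** of which the boundary edges are lifts (the tree edge of Lemma 5.1).
[cite: MartineauSevero2019, Lemma 5.1] -/
def hedge (β : BLift G Γ r x b) : Sym2 (MulAction.orbitRel.Quotient Γ V) := s(qmk Γ β.near, b)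

/-- The `ℋ`-edge is an edge of `ℋ`. [cite: MartineauSevero2019, Lemma 5.1] -/
theorem hedge_adj (β : BLift G Γ r x b) (hb : (orbitQuotientGraph G Γ).dist (qmk Γ x) b = r + 1) :
    (orbitQuotientGraph G Γ).Adj (qmk Γ β.near) b := by
  rcases qmk_adj_or_eq (Γ := Γ) β.adj with h | h
  · exact absurd (h.trans β.far_proj) (β.near_proj_ne hb)
  · rw [β.far_proj] at h; exact h

/-- The `ℋ`-edge lies in `E(B_{r+1}(π x))`, with its first endpoint in `B_r(π x)`. [cite: MartineauSevero2019, Lemma 5.1 (S_{r+1/2}(u))] -/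
theorem hedge_mem_edgesInBall (hG : G.Connected) (β : BLift G Γ r x b)
    (hb : (orbitQuotientGraph G Γ).dist (qmk Γ x) b = r + 1) :
    β.hedge ∈ edgesInBall (orbitQuotientGraph G Γ) (qmk Γ x) (r + 1) := by
  refine ⟨β.hedge_adj hb, graphBall_mono _ _ (Nat.le_succ r) β.near_proj_mem, ?_⟩
  exact mem_graphBall_of_dist_le (quot_connected hG) hb.le

/-- **The first boundary edge** `s(near, far)`. [cite: MartineauSevero2019, Lemma 5.1 (the lift in 𝒯_x)] -/
def edge₁ (β : BLift G Γ r x b) : Sym2 V := s(β.near, β.far)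

/-- **The second boundary edge** `s(g near, g far)`, the translate. [cite: MartineauSevero2019, Lemma 5.1 (the lift in 𝒯_y = g𝒯_x)] -/
def edge₂ (β : BLift G Γ r x b) (g : Γ) : Sym2 V := s(g • β.near, g • β.far)

/-- The first boundary edge is an edge of `𝒢`. [folklore] -/
theorem edge₁_mem_edgeSet (β : BLift G Γ r x b) : β.edge₁ ∈ G.edgeSet := β.adj

/-- The second boundary edge is an edge of `𝒢`. [folklore] -/
theorem edge₂_mem_edgeSet (hact : IsActionByAut G Γ) (β : BLift G Γ r x b) (g : Γ) : β.edge₂ g ∈ G.edgeSet :=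
  (hact g _ _).2 β.adj

/-- The first boundary edge projects to the `ℋ`-edge. [cite: MartineauSevero2019, Lemma 5.1] -/
theorem map_edge₁ (β : BLift G Γ r x b) : Sym2.map (qmk Γ) β.edge₁ = β.hedge := by
  simp [edge₁, hedge, β.far_proj]

/-- The second boundary edge projects to the same `ℋ`-edge. [cite: MartineauSevero2019, Lemma 5.1 ("π(z) = π(gz)")] -/
theorem map_edge₂ (β : BLift G Γ r x b) (g : Γ) : Sym2.map (qmk Γ) (β.edge₂ g) = β.hedge := by
  simp [edge₂, hedge, β.far_proj]

/-- **The two boundary edges are distinct** when `g ≠ 1` acts freely (vertex-disjointness of the two lifts,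
Lemma 7.1). [cite: MartineauSevero2019, Lemma 7.1] -/
theorem edge₁_ne_edge₂ (hfree : ∀ (g : Γ) (x : V), g • x = x → g = 1) (β : BLift G Γ r x b)
    (hb : (orbitQuotientGraph G Γ).dist (qmk Γ x) b = r + 1) {g : Γ} (hg : g ≠ 1) : β.edge₁ ≠ β.edge₂ g := by
  intro h
  rw [edge₁, edge₂, Sym2.eq_iff] at h
  rcases h with ⟨h1, -⟩ | ⟨h1, -⟩
  · exact hg (hfree g β.near h1.symm)
  · -- `near = g • far` would put `near` above `b`
    refine β.near_proj_ne hb ?_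
    rw [h1, qmk_smul, β.far_proj]

/-- Endpoints of the first boundary edge project into `B_{r+1}(π x)`. [cite: MartineauSevero2019, Lemma 5.1] -/
theorem proj_mem_of_mem_edge₁ (hG : G.Connected) (β : BLift G Γ r x b)
    (hb : (orbitQuotientGraph G Γ).dist (qmk Γ x) b = r + 1) {z : V} (hz : z ∈ β.edge₁) :
    qmk Γ z ∈ graphBall (orbitQuotientGraph G Γ) (qmk Γ x) (r + 1) := by
  rcases Sym2.mem_iff.1 hz with rfl | rfl
  · exact graphBall_mono _ _ (Nat.le_succ r) β.near_proj_mem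
  · rw [β.far_proj]; exact mem_graphBall_of_dist_le (quot_connected hG) hb.le

/-- Endpoints of the second boundary edge project into `B_{r+1}(π x)`. [cite: MartineauSevero2019, Lemma 5.1] -/
theorem proj_mem_of_mem_edge₂ (hG : G.Connected) (β : BLift G Γ r x b)
    (hb : (orbitQuotientGraph G Γ).dist (qmk Γ x) b = r + 1) (g : Γ) {z : V} (hz : z ∈ β.edge₂ g) :
    qmk Γ z ∈ graphBall (orbitQuotientGraph G Γ) (qmk Γ x) (r + 1) := by
  rcases Sym2.mem_iff.1 hz with rfl | rfl
  · rw [qmk_smul]; exact graphBall_mono _ _ (Nat.le_succ r) β.near_proj_mem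
  · rw [qmk_smul, β.far_proj]; exact mem_graphBall_of_dist_le (quot_connected hG) hb.le

/-- The far endpoint of the first boundary edge lies above `b` and is reached from `near`. [folklore] -/
theorem far_spec (β : BLift G Γ r x b) : G.Adj β.near β.far ∧ qmk Γ β.far = b := ⟨β.adj, β.far_proj⟩

/-- The far endpoint of the second boundary edge lies above `b` and is reached from `g • near`. [folklore] -/
theorem smul_far_spec (hact : IsActionByAut G Γ) (β : BLift G Γ r x b) (g : Γ) :
    G.Adj (g • β.near) (g • β.far) ∧ qmk Γ (g • β.far) = b :=
  ⟨(hact g _ _).2 β.adj, by rw [qmk_smul, β.far_proj]⟩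

end BLift

end Literature.Probability.Percolation
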